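import Summits.HodgeConjecture.HodgeConjecture.Theses.NikulinTwinTransport
import Literature.AlgebraicGeometry.Surfaces.K3SurfaceProofs
import Literature.AlgebraicGeometry.HodgeTheory.ComplexGysinHodgeType
import Literature.AlgebraicGeometry.HodgeTheory.SupportedClassesHodgeConiveau
import Literature.AlgebraicGeometry.HodgeTheory.HodgeModelExistence

/-!
# `HodgeSimilitudeAlgebraic` (stmt-HodgeConjecture-13676) · Negative · the type hypothesis is load-bearing

Negative-side knowledge for the crux `NikulinTwinTransport.HodgeSimilitudeAlgebraic`, extracted from
the standing disprover's work file `Cruxes/HodgeSimilitudeAlgebraic/Disproof.lean` (§2b;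
refuter-cdisprove-stmt-HodgeConjecture-13676-g3-0, cycle 2, 2026-08-16).

`hodgeSimilitudeAlgebraic_false_without_htype`: the crux with its type-preservation hypothesis
DROPPED ("every rational `r`-similitude `H²(S′(ℂ);ℂ) → H²(S(ℂ);ℂ)` between projective K3 surfaces is
induced by an algebraic class") is FALSE on the tree's real carriers, for every orientation family
with Poincaré duality, granted five named facts of the tree: the projective surjectivity of the K3
period map (`Huybrechts_K3_periodSurjective_projective`), independence of `H^{p,q}` of the Hodge
model (`hodgePQ_independent_of_hodgeModel`), existence of Hodge models (`nonempty_hodgeModel`),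
de Rham's theorem (`exists_deRhamIsoFamily`) and Grothendieck's coniveau fact
(`Grothendieck1969_supportedClasses_le_hodgeConiveau`, `N²H⁴ ⊆ H^{2,2}`). Witness: the marked
projective K3 surface `(S, φ)` with the explicit CM period `x₀ = (e₁+f₁) + i(e₂+f₂)` and the rational
isometry `ψ = φ⁻¹ ∘ s_w ∘ φ`, `w = e₁ + f₁`: `s_w x₀ = x₀ − 2w ∉ ℂ·x₀`, whereas the action
`x ↦ fst_*(snd^* x ∪ γ)` of an algebraic `γ ∈ N²H⁴(S × S) ⊆ H^{2,2}` preserves the `(2,0)`-line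
(`isOfHodgeType_complexGysin`, `cupPreservesHodgeType_of_nonempty_hodgeModel`,
`IsOfHodgeType.map_of_independent`). So any proof of the crux must use `htype`; the companion
hypothesis `hrat` is load-bearing only generically (at CM points `End_Hdg(T) ⊗ ℂ` contains the
irrational type-preserving isometries), see the work file §4.

## References

* [Huybrechts2016K3] D. Huybrechts, Lectures on K3 Surfaces (2016), Ch. 6 §1.1, Rem. 3.3; Ch. 3 §2.
* [VoisinHodgeI2002] C. Voisin, Hodge Theory and Complex Algebraic Geometry I (2002), §7.3.2,
  Prop. 11.20.
* [GrothendieckTopology1969] A. Grothendieck, Hodge's general conjecture is false for trivial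
  reasons, Topology 8 (1969), p. 300.
-/

noncomputable section

open CategoryTheory MonoidalCategory
open scoped Manifold Matrix
open Literature.AlgebraicGeometry.Motives Literature.AlgebraicGeometry.HodgeTheory
open Literature.AlgebraicGeometry.Surfaces Literature.Geometry.Kaehler
open Literature.AlgebraicTopology.SingularHomology
open Literature.NumberTheory.Transcendental (exists_deRhamIsoFamily)
open Literature.LinearAlgebra.QuadraticForm
open Summit.HodgeConjecture.HodgeConjecture.Theses.NikulinTwinTransport

namespace Summit.HodgeConjecture.HodgeConjecture.Theorems.HodgeSimilitudeAlgebraic.Negative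


/-- `WithoutHtype[c]`: the body of the route decl `HodgeSimilitudeAlgebraic` at multiplier `c` with
its type-preservation hypothesis dropped (everything else verbatim). Local notation only. -/
local notation3 (prettyPrint := false) "WithoutHtype[" c "]" =>
  ∀ (μ : OrientationFamily), μ.HasPoincareDuality →
    ∀ (S S' : SchemeOver ℂ)
      (hS : (IsSmoothProjective 2 S ∧ Subsingleton (structureSheafCohomology S.left 1) ∧
        ∃ (A : HodgeModel 2 S) (η : MForm 𝓘(ℝ, A.model) A.carrier ℂ 2),
          IsHolomorphicInCharts η ∧ ∀ x, η x ≠ 0))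
      (hS' : (IsSmoothProjective 2 S' ∧ Subsingleton (structureSheafCohomology S'.left 1) ∧
        ∃ (A : HodgeModel 2 S') (η : MForm 𝓘(ℝ, A.model) A.carrier ℂ 2),
          IsHolomorphicInCharts η ∧ ∀ x, η x ≠ 0))
      (p : complexBetti S (2 * 2)) (p' : complexBetti S' (2 * 2)),
      (IsIntegralClass p ∧ ∀ q : complexBetti S (2 * 2), IsIntegralClass q → ∃ n : ℤ, q = n • p) →
      (IsIntegralClass p' ∧
        ∀ q : complexBetti S' (2 * 2), IsIntegralClass q → ∃ n : ℤ, q = n • p') →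
      ∀ (ψ : complexBetti S' (2 * 1) →ₗ[ℂ] complexBetti S (2 * 1)),
        (∀ x, IsRationalClass x → IsRationalClass (ψ x)) →
        (∀ (x y : complexBetti S' (2 * 1)) (a : ℂ),
          cupProduct (rfl : 2 * 1 + 2 * 1 = 2 * 2) x y = a • p' →
            cupProduct (rfl : 2 * 1 + 2 * 1 = 2 * 2) (ψ x) (ψ y) = (c * a) • p) →
        ∃ γ ∈ algebraicClasses (MonoidalCategoryStruct.tensorObj S S') 2,
          ∀ x : complexBetti S' (2 * 1),
            ψ x = complexGysin μ (IsSmoothProjective.tensor_holds hS.1 hS'.1) hS.1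
              (SemiCartesianMonoidalCategory.fst S S')
              (rfl : 2 * 1 + 2 * 2 + 2 * 2 = 2 * 1 + 2 * (2 + 2))
              (cupProduct (rfl : 2 * 1 + 2 * 2 = 2 * 1 + 2 * 2)
                (complexBetti.map (SemiCartesianMonoidalCategory.snd S S') (2 * 1) x) γ)

/-- The explicit projective period vector `x₀ = (e₁ + f₁) + i (e₂ + f₂)` of
`exists_k3PeriodVector_projective`. Local notation only. -/
local notation3 (prettyPrint := false) "x₀P" =>
  (Sum.elim 0 (Sum.elim ![1, 1] (Sum.elim ![Complex.I, Complex.I] 0)) : K3Index → ℂ)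

/-- The lattice vector `w = e₁ + f₁` (`(w.w) = 2`, `(w.x₀) = 2`). Local notation only. -/
local notation3 (prettyPrint := false) "wV" =>
  (Sum.elim 0 (Sum.elim ![1, 1] (Sum.elim 0 0)) : K3Index → ℤ)

/-- The lattice vector `u = e₃ + f₃ ⊥ x₀` with `u² = 2 > 0` (projectivity). Local notation only. -/
local notation3 (prettyPrint := false) "uV" =>
  (Sum.elim 0 (Sum.elim 0 (Sum.elim 0 ![1, 1])) : K3Index → ℤ)

/-- `(x₀.x₀) = 0`. [cite: Huybrechts2016K3, Ch. 6 §1.1] -/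
theorem x₀P_sq : k3Form x₀P x₀P = 0 := by
  simp [k3Form, k3Gram, hyperbolicPlaneGram, Fintype.sum_sum_type, Fin.sum_univ_two]

/-- `(x̄₀.x₀) = 4 > 0`. [cite: Huybrechts2016K3, Ch. 6 §1.1] -/
theorem x₀P_pos : 0 < (k3Form (star x₀P) x₀P).re := by
  simp [k3Form, k3Gram, hyperbolicPlaneGram, Fintype.sum_sum_type, Fin.sum_univ_two]

/-- `(u.x₀) = 0`. [folklore] -/
theorem uV_x₀P : k3Form (fun i => (uV i : ℂ)) x₀P = 0 := by
  simp [k3Form, k3Gram, hyperbolicPlaneGram, Fintype.sum_sum_type, Fin.sum_univ_two]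

/-- `(u.u) = 2 > 0`. [folklore] -/
theorem uV_sq : 0 < ∑ i, ∑ j, uV i * k3Gram i j * uV j := by
  simp [k3Gram, hyperbolicPlaneGram, Fintype.sum_sum_type, Fin.sum_univ_two]

/-- `(w.w) = 2`. [folklore] -/
theorem wV_sq : k3Form (fun i => (wV i : ℂ)) (fun i => (wV i : ℂ)) = 2 := by
  simp [k3Form, k3Gram, hyperbolicPlaneGram, Fintype.sum_sum_type, Fin.sum_univ_two]
  norm_num

/-- `(w.x₀) = 2`. [folklore] -/
theorem wV_x₀P : k3Form (fun i => (wV i : ℂ)) x₀P = 2 := by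
  simp [k3Form, k3Gram, hyperbolicPlaneGram, Fintype.sum_sum_type, Fin.sum_univ_two]
  norm_num

/-- `s_w(x₀) = x₀ − 2w` is not proportional to `x₀` (compare the `e₁`- and `e₂`-coordinates). [folklore] -/
theorem reflection_x₀P_ne_smul (t : ℂ) : k3ReflectionC wV x₀P ≠ t • x₀P := by
  intro h
  rw [k3ReflectionC_apply, wV_sq, wV_x₀P] at h
  have h1 := congrFun h (Sum.inr (Sum.inl 0))
  have h2 := congrFun h (Sum.inr (Sum.inr (Sum.inl 0)))
  simp at h1 h2
  rw [← h2] at h1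
  norm_num at h1

/-- **The crux without `htype` is false at multiplier `1`** (modulo the five named facts, for every
orientation family with Poincaré duality): on the marked projective K3 surface with period `x₀`, the
rational isometry `ψ = φ⁻¹ ∘ s_w ∘ φ` moves the `(2,0)`-line (`s_w x₀ ∉ ℂ x₀`), whereas `[γ]_*` of an
algebraic `γ` (of type `(2,2)` by the coniveau fact) preserves it (Gysin, cup product and pull-back
respect Hodge types). [cite: VoisinHodgeI2002, §7.3.2 and Prop. 11.20]
[cite: Huybrechts2016K3, Ch. 6 Rem. 3.3] -/
theorem hodgeSimilitudeAlgebraic_false_without_htype_at_one (hP : Huybrechts_K3_periodSurjective_projective)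
    (hI : hodgePQ_independent_of_hodgeModel)
    (hM : ∀ (m : ℕ) (Y : SchemeOver ℂ), nonempty_hodgeModel m Y)
    (hdR : ∀ (E : Type) [NormedAddCommGroup E] [NormedSpace ℂ E] [FiniteDimensional ℂ E],
      exists_deRhamIsoFamily 𝓘(ℝ, E))
    (hG : Grothendieck1969_supportedClasses_le_hodgeConiveau)
    (μ : OrientationFamily) (hμ : μ.HasPoincareDuality) :
    ¬ WithoutHtype[(1 : ℂ)] := by
  intro h
  -- a marked projective K3 surface with period `x₀`
  obtain ⟨S, hS, φ, p, hpint, hpgen, hφint, hφcup, h20, h20span⟩ :=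
    hP x₀P x₀P_sq x₀P_pos ⟨uV, uV_x₀P, uV_sq⟩
  -- the rational isometry `ψ = φ⁻¹ ∘ s_w ∘ φ`
  set σ : Module.End ℂ (K3Index → ℂ) := k3ReflectionC wV with hσ
  set ψ : complexBetti S (2 * 1) →ₗ[ℂ] complexBetti S (2 * 1) :=
    φ.symm.toLinearMap ∘ₗ σ ∘ₗ φ.toLinearMap with hψ
  have hψapply : ∀ y, ψ y = φ.symm (σ (φ y)) := fun y => rfl
  have hrat : ∀ y, IsRationalClass y → IsRationalClass (ψ y) := by
    intro y hy
    obtain ⟨u, hu⟩ := (isRationalClass_iff_of_marking hS φ hφint y).1 hy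
    refine (isRationalClass_iff_of_marking hS φ hφint _).2 ⟨reflection k3FormRat (fun j => (wV j : ℚ)) u, ?_⟩
    rw [hψapply, LinearEquiv.apply_symm_apply, hu, hσ, k3ReflectionC_ratCast]
  have hsim : ∀ (x y : complexBetti S (2 * 1)) (a : ℂ),
      cupProduct (rfl : 2 * 1 + 2 * 1 = 2 * 2) x y = a • p →
        cupProduct (rfl : 2 * 1 + 2 * 1 = 2 * 2) (ψ x) (ψ y) = ((1 : ℂ) * a) • p := by
    intro x y a hxy
    rw [one_mul, hφcup, hψapply, hψapply, LinearEquiv.apply_symm_apply, LinearEquiv.apply_symm_apply,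
      hσ, k3Form_k3ReflectionC, ← hφcup, hxy]
  -- the crux without `htype` makes `ψ` algebraic
  obtain ⟨γ, hγ, hψγ⟩ := h μ hμ S S hS hS p p ⟨hpint, hpgen⟩ ⟨hpint, hpgen⟩ ψ hrat hsim
  -- `γ ∈ N²H⁴(S × S)` is of type `(2,2)` (Grothendieck's coniveau fact)
  have hSS : IsSmoothProjective (2 + 2) (S ⊗ S) := IsSmoothProjective.tensor_holds hS.1 hS.1
  obtain ⟨A⟩ := (hM (2 + 2) (S ⊗ S)).nonempty hSS
  have hγT : IsOfHodgeType (2 + 2) (S ⊗ S) (2 * 2) 2 2 γ := by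
    have hc : A.pullback (2 * 2) γ ∈ A.hodgeConiveau (2 * 2) 2 := hG hSS A (2 * 2) 2 ⟨γ, hγ, rfl⟩
    have hle : A.hodgeConiveau (2 * 2) 2 ≤ A.hodgePQ (2 * 2) 2 2 := by
      refine iSup_le fun p => iSup_le fun q => iSup_le fun hpq => iSup_le fun hp =>
        iSup_le fun hq => ?_
      obtain ⟨rfl, rfl⟩ : p = 2 ∧ q = 2 := by omega
      exact le_rfl
    exact ⟨A, hle hc⟩
  -- `snd^*(φ⁻¹ x₀)` is of type `(2,0)`, its cup with `γ` of type `(4,2)`, and `fst_*` of that of type `(2,0)`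
  have hsndT : IsOfHodgeType (2 + 2) (S ⊗ S) (2 * 1) 2 0
      (complexBetti.map (SemiCartesianMonoidalCategory.snd S S) (2 * 1) (φ.symm x₀P)) :=
    IsOfHodgeType.map_of_independent hI h20 hSS hS.1 A (SemiCartesianMonoidalCategory.snd S S)
  have hcupT := cupPreservesHodgeType_of_nonempty_hodgeModel hI (hM (2 + 2) (S ⊗ S)) hdR hSS
    (rfl : 2 * 1 + 2 * 2 = 2 * 1 + 2 * 2) hsndT hγT
  have hgysT : IsOfHodgeType 2 S (2 * 1) 2 0 (ψ (φ.symm x₀P)) := by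
    rw [hψγ]
    exact isOfHodgeType_complexGysin hI hM hdR μ hSS hS.1 (SemiCartesianMonoidalCategory.fst S S)
      (rfl : 2 * 1 + 2 * 2 + 2 * 2 = 2 * 1 + 2 * (2 + 2)) (by norm_num) (by norm_num) hcupT
  -- hence `s_w x₀ ∈ ℂ x₀`: contradiction
  obtain ⟨t, ht⟩ := h20span _ hgysT
  rw [hψapply, LinearEquiv.apply_symm_apply] at ht
  have ht' : σ x₀P = t • x₀P := by
    have := congrArg φ ht
    rwa [LinearEquiv.apply_symm_apply, map_smul, LinearEquiv.apply_symm_apply] at this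
  exact reflection_x₀P_ne_smul t ht'

/-- **`htype` is load-bearing for `HodgeSimilitudeAlgebraic`**: the crux with its type-preservation
hypothesis dropped (all multipliers `r > 0`, everything else verbatim) is false, modulo the five named
facts and an orientation family with Poincaré duality (specialise `r = 1`).
[cite: VoisinHodgeI2002, §7.3.2 and Prop. 11.20] -/
theorem hodgeSimilitudeAlgebraic_false_without_htype (hP : Huybrechts_K3_periodSurjective_projective)
    (hI : hodgePQ_independent_of_hodgeModel)
    (hM : ∀ (m : ℕ) (Y : SchemeOver ℂ), nonempty_hodgeModel m Y)
    (hdR : ∀ (E : Type) [NormedAddCommGroup E] [NormedSpace ℂ E] [FiniteDimensional ℂ E],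
      exists_deRhamIsoFamily 𝓘(ℝ, E))
    (hG : Grothendieck1969_supportedClasses_le_hodgeConiveau)
    (μ : OrientationFamily) (hμ : μ.HasPoincareDuality) :
    ¬ ∀ r : ℚ, 0 < r → WithoutHtype[(r : ℂ)] := by
  intro h
  have h1 := h 1 one_pos
  rw [Rat.cast_one] at h1
  exact hodgeSimilitudeAlgebraic_false_without_htype_at_one hP hI hM hdR hG μ hμ h1


end Summit.HodgeConjecture.HodgeConjecture.Theorems.HodgeSimilitudeAlgebraic.Negative

end
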